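import Summits.HodgeConjecture.CorCM.MumfordTateRankSixSplitting
import Literature.AlgebraicGeometry.Motives.HodgeLieBlockSummandSurjective
import Literature.AlgebraicGeometry.HodgeTheory.AbelianVarietyPolarizedAutomorphisms
import Literature.AlgebraicGeometry.HodgeTheory.BettiOneHodgeStructureModelIndependence
import HarnessLib

/-!
# The rungs `dim MT(H¹(X)) ≤ 6`, V: the Hodge Lie algebra of the CM part is the restriction of `Lie Hg(H¹X)`

COR-CM (cell `pub-hodgecm2`, seat `b27` gen 37, count-neutral lane MT-RANK-SIX-ISOGENY part C; theorems only, no definition,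
no named fact; UNCONDITIONAL — nothing here uses or asserts HC_CM).

Let `X ∼ Y ⊞ Z` be the splitting of `CorCM/MumfordTateRankSixSplitting` along the central idempotent `e` (`t : X → Z`,
`j : Z → X`, `j^* t^* = M`, `t^* j^* = M − M e^*` on `H¹`).  The Hodge Lie algebra of `X` is block diagonal for `1 − e^*`
(`X' − e^* X' ∈ Lie Hg(H¹X)`), so the abstract surjectivity theorem `HodgeStructure.comp_mem_hodgeLie_of_block`
(`Motives/HodgeLieBlockSummandSurjective`) applies to the retract `ι = t^*`, `π = M⁻¹ j^*` of `ℚ`-Hodge structures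
`H¹(Z) ⇄ H¹(X)` (pull-backs are morphisms of the Betti Hodge structures, `map_F_le_hodge_one`):

* `map_F_le_hodge_one` — `u^*` respects the Hodge filtrations of `BettiUniverse.hodge _ _ 1` (via `bettiOneHom` and the
  model independence `BettiUniverse.hodge_one_eq_cast_bettiOneHodgeStructure`).
* **`hodgeLie_hodge_one_eq_image_of_block`** — for `t : X → Z`, `j : Z → X` with `j^* t^* = M ≠ 0`, `t^* j^* = M − M p` and
  `Lie Hg(H¹X)` block diagonal for `p`: `Lie Hg(H¹Z) = { M⁻¹ j^* X' t^* | X' ∈ Lie Hg(H¹X) }`.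
* **`exists_cmPart_hodgeLie_eq_image_of_finrank_derived_eq_three`** — for `X` with `dim [Lie Hg(H¹X), Lie Hg(H¹X)] = 3`:
  the CM part `Z` of the splitting has `Lie Hg(H¹Z)` EQUAL to the restriction of `Lie Hg(H¹X)` (hence a quotient of it:
  `dim Lie Hg(H¹Z) ≤ dim Lie Hg(H¹X)`), the first step towards `dim Hg(Z) = dim MT(H¹X) − 4`.

## References

* [MoonenZarhin1999LowDim] B. Moonen, Yu. Zarhin, *Hodge classes on abelian varieties of low dimension*, Math. Ann.
  315 (1999), §2 and §3 first paragraph.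
* [Deligne1982HodgeCycles] P. Deligne, *Hodge cycles on abelian varieties*, LNM 900 (1982), I §3.1 and Prop. 3.4.
* [VoisinHodgeI2002] C. Voisin, *Hodge Theory and Complex Algebraic Geometry I*, §7.3.2.
* [MumfordAV1970] D. Mumford, *Abelian Varieties* (1970), §19 Thm. 1 and p. 169.
-/

noncomputable section

open scoped TensorProduct
open CategoryTheory CategoryTheory.Limits Module

namespace Summit.HodgeConjecture.CorCM

open Literature.AlgebraicGeometry.Motives
open Literature.AlgebraicGeometry.Motives.AbelianVariety
open Literature.AlgebraicGeometry.Motives.HodgeStructure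
open Literature.AlgebraicGeometry.HodgeTheory
open Literature.AlgebraicGeometry.ComplexMultiplication (bettiRep)
open Literature.AlgebraicGeometry.Milne1999 (IsOfCMType)

variable [HodgeTensorFacts.{0, 0}]

omit [HodgeTensorFacts.{0, 0}] in
/-- **Pull-back along a homomorphism of complex abelian varieties respects the Hodge filtration on `H¹`**: for
`u : A → A'`, `u^*` maps `F^p H¹(A') ` into `F^p H¹(A)` for the Betti Hodge structures `BettiUniverse.hodge _ _ 1`
(`bettiOneHom` in any Hodge-symmetric model, transported by `BettiUniverse.hodge_one_eq_cast_bettiOneHodgeStructure`).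
[cite: VoisinHodgeI2002, §7.3.2] -/
theorem map_F_le_hodge_one {A A' : AbelianVariety ℂ} (hA : IsSmoothProjective A.dim A.X)
    (hA' : IsSmoothProjective A'.dim A'.X) (u : A ⟶ A') (p : ℤ) :
    haveI := BettiUniverse.finite hA 1
    haveI := BettiUniverse.finite hA' 1
    ((BettiUniverse.hodge exists_isReal_hodgeModel_holds hA' 1).F p).map
        ((bettiCohomology.map u.hom.hom.hom 1).hom.baseChange ℂ) ≤
      (BettiUniverse.hodge exists_isReal_hodgeModel_holds hA 1).F p := by
  haveI := BettiUniverse.finite hA 1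
  haveI := BettiUniverse.finite hA' 1
  have h := (Literature.AlgebraicGeometry.HodgeTheory.AbelianVariety.bettiOneHom (BettiUniverse.realHodgeModel exists_isReal_hodgeModel_holds hA)
    (BettiUniverse.realHodgeModel_isHodgeSymmetric exists_isReal_hodgeModel_holds hA)
    (BettiUniverse.realHodgeModel exists_isReal_hodgeModel_holds hA')
    (BettiUniverse.realHodgeModel_isHodgeSymmetric exists_isReal_hodgeModel_holds hA') u).map_F_le p
  rw [BettiUniverse.hodge_one_eq_cast_bettiOneHodgeStructure exists_isReal_hodgeModel_holds
      hodgePQ_independent_of_hodgeModel_holds A' hA' (BettiUniverse.realHodgeModel exists_isReal_hodgeModel_holds hA')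
      (BettiUniverse.realHodgeModel_isHodgeSymmetric exists_isReal_hodgeModel_holds hA'),
    BettiUniverse.hodge_one_eq_cast_bettiOneHodgeStructure exists_isReal_hodgeModel_holds
      hodgePQ_independent_of_hodgeModel_holds A hA (BettiUniverse.realHodgeModel exists_isReal_hodgeModel_holds hA)
      (BettiUniverse.realHodgeModel_isHodgeSymmetric exists_isReal_hodgeModel_holds hA),
    HodgeStructure.cast_F, HodgeStructure.cast_F]
  exact h

/-- **`Lie Hg(H¹Z)` is the restriction of `Lie Hg(H¹X)` along a quasi-retraction with block-diagonal Hodge Lie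
algebra.**  Let `t : X → Z`, `j : Z → X` be homomorphisms of complex abelian varieties with `j^* t^* = M ≠ 0` on `H¹(Z)`
and `t^* j^* = M − M p` on `H¹(X)` for an endomorphism `p` such that `X' − p X' ∈ Lie Hg(H¹X)` for every
`X' ∈ Lie Hg(H¹X)`.  Then `Lie Hg(H¹Z) = { M⁻¹ · j^* X' t^* | X' ∈ Lie Hg(H¹X) }` — the restriction to the direct summand
`H¹(Z)` (retract `ι = t^*`, `π = M⁻¹ j^*`, `ιπ = 1 − p`) is ONTO (`HodgeStructure.hodgeLie_eq_restrict_of_block`).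
[cite: Deligne1982HodgeCycles, I §3.1 and Prop. 3.4] [cite: MoonenZarhin1999LowDim, §3] -/
theorem hodgeLie_hodge_one_eq_image_of_block {X Z : AbelianVariety ℂ} (hX : IsSmoothProjective X.dim X.X)
    (hZ : IsSmoothProjective Z.dim Z.X) (t : X ⟶ Z) (j : Z ⟶ X) {M : ℕ} (hM : M ≠ 0)
    {p : Module.End ℚ (bettiCohomology X.X 1)}
    (hjt : (bettiCohomology.map j.hom.hom.hom 1).hom ∘ₗ (bettiCohomology.map t.hom.hom.hom 1).hom =
      (M : ℚ) • LinearMap.id)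
    (htj : (bettiCohomology.map t.hom.hom.hom 1).hom ∘ₗ (bettiCohomology.map j.hom.hom.hom 1).hom =
      (M : ℚ) • LinearMap.id - (M : ℚ) • p)
    (hblk : haveI := BettiUniverse.finite hX 1
      ∀ X' ∈ (BettiUniverse.hodge exists_isReal_hodgeModel_holds hX 1).hodgeLie,
        X' - p * X' ∈ (BettiUniverse.hodge exists_isReal_hodgeModel_holds hX 1).hodgeLie) :
    haveI := BettiUniverse.finite hX 1
    haveI := BettiUniverse.finite hZ 1
    ((BettiUniverse.hodge exists_isReal_hodgeModel_holds hZ 1).hodgeLie : Set (Module.End ℚ (bettiCohomology Z.X 1))) =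
      (fun X' : Module.End ℚ (bettiCohomology X.X 1) =>
        (M : ℚ)⁻¹ • ((bettiCohomology.map j.hom.hom.hom 1).hom ∘ₗ X' ∘ₗ (bettiCohomology.map t.hom.hom.hom 1).hom)) ''
        ((BettiUniverse.hodge exists_isReal_hodgeModel_holds hX 1).hodgeLie : Set (Module.End ℚ (bettiCohomology X.X 1))) := by
  haveI := BettiUniverse.finite hX 1
  haveI := BettiUniverse.finite hZ 1
  have hM' : (M : ℚ) ≠ 0 := Nat.cast_ne_zero.2 hM
  -- the retract `ι = t^*`, `π = M⁻¹ j^*`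
  have hπF : ∀ q, ((BettiUniverse.hodge exists_isReal_hodgeModel_holds hX 1).F q).map
      (((M : ℚ)⁻¹ • (bettiCohomology.map j.hom.hom.hom 1).hom).baseChange ℂ) ≤
      (BettiUniverse.hodge exists_isReal_hodgeModel_holds hZ 1).F q := by
    intro q
    rintro _ ⟨x, hx, rfl⟩
    rw [LinearMap.baseChange_smul, LinearMap.smul_apply]
    exact Submodule.smul_of_tower_mem _ (M : ℚ)⁻¹ (map_F_le_hodge_one hZ hX j q ⟨x, hx, rfl⟩)
  let ιH : Hom (BettiUniverse.hodge exists_isReal_hodgeModel_holds hZ 1)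
      (BettiUniverse.hodge exists_isReal_hodgeModel_holds hX 1) :=
    ⟨(bettiCohomology.map t.hom.hom.hom 1).hom, fun q => map_F_le_hodge_one hX hZ t q⟩
  let πH : Hom (BettiUniverse.hodge exists_isReal_hodgeModel_holds hX 1)
      (BettiUniverse.hodge exists_isReal_hodgeModel_holds hZ 1) :=
    ⟨(M : ℚ)⁻¹ • (bettiCohomology.map j.hom.hom.hom 1).hom, hπF⟩
  have hιH : ιH.toLinearMap = (bettiCohomology.map t.hom.hom.hom 1).hom := rfl
  have hπH : πH.toLinearMap = (M : ℚ)⁻¹ • (bettiCohomology.map j.hom.hom.hom 1).hom := rfl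
  have hπι : ∀ v, πH.toLinearMap (ιH.toLinearMap v) = v := by
    intro v
    rw [hιH, hπH, LinearMap.smul_apply, ← LinearMap.comp_apply, hjt, LinearMap.smul_apply, LinearMap.id_apply, smul_smul,
      inv_mul_cancel₀ hM', one_smul]
  have hιπ : ιH.toLinearMap ∘ₗ πH.toLinearMap = 1 - p := by
    rw [hιH, hπH, LinearMap.comp_smul, htj, smul_sub, smul_smul, smul_smul, inv_mul_cancel₀ hM', one_smul, one_smul,
      Module.End.one_eq_id]
  have hblock : ∀ X' ∈ (BettiUniverse.hodge exists_isReal_hodgeModel_holds hX 1).hodgeLie,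
      (ιH.toLinearMap ∘ₗ πH.toLinearMap) ∘ₗ X' ∈ (BettiUniverse.hodge exists_isReal_hodgeModel_holds hX 1).hodgeLie := by
    intro X' hX'
    rw [hιπ]
    have : ((1 - p) ∘ₗ X' : Module.End ℚ _) = X' - p * X' := by
      rw [← Module.End.mul_eq_comp, sub_mul, one_mul]
    rw [this]
    exact hblk X' hX'
  have h := hodgeLie_eq_restrict_of_block ιH πH hπι hblock
  rw [h]
  refine Set.image_congr fun X' _ => ?_
  rw [hιH, hπH, LinearMap.smul_comp]

variable {X : AbelianVariety ℂ} {n : ℕ}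

/-- **The Hodge Lie algebra of the CM part is the restriction of `Lie Hg(H¹X)`.**  For `X` with `0 < dim X` and
`dim [Lie Hg(H¹X), Lie Hg(H¹X)] = 3` (e.g. `X` NOT of CM type with `dim MT(H¹X) ≤ 6`), the splitting
`X ∼ Y ⊞ Z` of `exists_quasiRetraction_splitting_of_finrank_derived_eq_three` (`Z` of CM type, `Y` not) has
`Lie Hg(H¹Z) = { M⁻¹ j^* X' t^* | X' ∈ Lie Hg(H¹X) }`, and the centre `𝔷` of `Lie Hg(H¹X)` is killed by `e^*`.
[cite: MoonenZarhin1999LowDim, §2 and §3] [cite: Deligne1982HodgeCycles, I Prop. 3.4] [cite: MumfordAV1970, §19 Thm. 1] -/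
theorem exists_cmPart_hodgeLie_eq_image_of_finrank_derived_eq_three (hX : IsSmoothProjective n X.X) (h0 : 0 < X.dim)
    (h3 : haveI := BettiUniverse.finite hX 1
      Module.finrank ℚ ↥(Submodule.span ℚ {B | ∃ X' ∈ (BettiUniverse.hodge exists_isReal_hodgeModel_holds hX 1).hodgeLie,
        ∃ Y ∈ (BettiUniverse.hodge exists_isReal_hodgeModel_holds hX 1).hodgeLie, X' * Y - Y * X' = B}) = 3) :
    haveI := BettiUniverse.finite hX 1
    ∃ (e : X.endAlgebra) (M : ℕ) (Y Z : AbelianVariety ℂ) (i : Y ⟶ X) (t : X ⟶ Z) (j : Z ⟶ X),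
      e ∈ Subalgebra.center ℚ X.endAlgebra ∧ e * e = e ∧ e ≠ 0 ∧ M ≠ 0 ∧
      IsIsogeny (biprod.desc i j) ∧ Y.dim + Z.dim = X.dim ∧ IsOfCMType Z ∧ ¬ IsOfCMType Y ∧
      (∀ Z' ∈ (BettiUniverse.hodge exists_isReal_hodgeModel_holds hX 1).hodgeLie ⊓
          Subalgebra.toSubmodule (BettiUniverse.hodge exists_isReal_hodgeModel_holds hX 1).endAlg,
        Z' * MulOpposite.unop (bettiRep X e) = 0) ∧
      haveI := BettiUniverse.finite (AbelianVariety.isSmoothProjective_holds (A := Z)) 1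
      ((BettiUniverse.hodge exists_isReal_hodgeModel_holds (AbelianVariety.isSmoothProjective_holds (A := Z)) 1).hodgeLie :
          Set (Module.End ℚ (bettiCohomology Z.X 1))) =
        (fun X' : Module.End ℚ (bettiCohomology X.X 1) =>
          (M : ℚ)⁻¹ • ((bettiCohomology.map j.hom.hom.hom 1).hom ∘ₗ X' ∘ₗ (bettiCohomology.map t.hom.hom.hom 1).hom)) ''
          ((BettiUniverse.hodge exists_isReal_hodgeModel_holds hX 1).hodgeLie : Set (Module.End ℚ (bettiCohomology X.X 1))) := by
  have hn : X.dim = n := schemeDim_eq_holds hX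
  subst hn
  haveI := BettiUniverse.finite hX 1
  obtain ⟨e, M, F, Y, Z, h, i, t, j, hec, hee, he0, -, hM, -, -, -, -, -, -, -, -, hiso, hdimYZ, hZcm, hYcm, -,
    -, -, -, -, -, hjt, htj, hblk, hZe⟩ := exists_quasiRetraction_splitting_of_finrank_derived_eq_three hX h0 h3
  refine ⟨e, M, Y, Z, i, t, j, hec, hee, he0, hM, hiso, hdimYZ, hZcm, hYcm, hZe, ?_⟩
  exact hodgeLie_hodge_one_eq_image_of_block hX (AbelianVariety.isSmoothProjective_holds (A := Z)) t j hM hjt htj hblk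

end Summit.HodgeConjecture.CorCM

end
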